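import Summits.ValiantsHypothesis.ValiantsHypothesis.Theorems.DivisionGapPerDivisionHardStubMidRigid
import Summits.ValiantsHypothesis.ValiantsHypothesis.Theorems.DivisionGapPerDivisionHardStubGreedyRows
import Summits.ValiantsHypothesis.ValiantsHypothesis.Theorems.DivisionGapPerDivisionHardStubGenericCut
import Summits.ValiantsHypothesis.ValiantsHypothesis.Theorems.DivisionGapPerDivisionHardStubBlockFits

/-!
# Crux `DivisionGap.PerDivisionHard` (stmt-ValiantsHypothesis-5065), line `pair-descent-jss-endpoint` —
stub `stub_rookRigid` (skeleton v15, the lead's stub): K2 for cofactors CONSTANT ON A ROOK SET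

If the monomials of a nonzero torus-homogeneous `h ∈ ℝ≥0[x_ij]` agree on at least `b²` cells in
rook position (pairwise distinct rows, pairwise distinct columns), `b = (log₂ n + d)^d`, then some
placement of the block arsenal `G(b,1) ⊕ M₀` and some weight cutting out the placed face have a
top fibre with a single `G`-part — in fact a single monomial.

Proof.  Index `b²` of the rooks by the internal labels `(i, j, 0)` and extend "label ↦ row of its
rook" and "label ↦ column of its rook" (injective, by the rook condition) to labellings `eR`, `eC`
(`exists_blockEquiv_extend`), so that the doubly-internal cell `(row (i,j,0), col (i,j,0))` of every
path IS a rook (`exists_placement_on_rooks`).  The generic cut (`stub_genericCut`) exposes the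
placed face and its top fibre agrees off the face; two fibre monomials have equal margins (torus)
and agree on the rooks (hypothesis), hence are equal by the local rigidity `stub_midRigid`.  The
block fits as soon as `b + b² ≤ n` (`stub_blockFits`).
-/

noncomputable section

-- `Summit.ValiantsHypothesis.ValiantsHypothesis.…` is the tree's mandated single-conjunct layout
-- (Sub = Summit), so the duplicated namespace component is intended.
set_option linter.dupNamespace false

namespace Summit.ValiantsHypothesis.ValiantsHypothesis.Theorems.DivisionGapPerDivisionHard

open MvPolynomial Literature.Computability.AlgebraicComplexity
open Summit.ValiantsHypothesis.ValiantsHypothesis.Theorems.ZeroOneTransfer.Negative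
  (topComponent support_topComponent_subset topComponent_ne_zero)
open scoped NNReal

/-- **Placement on a rook set.**  Given `b²` cells in rook position (no two in a row, no two in a
column) and `b + b² ≤ n`, there is a placement `eR eC` of `G(b,1) ⊕ M₀` whose doubly-internal cell
`(row (i,j,0), col (i,j,0))` lies in the rook set for every path `(i, j)`: index the rooks by the
internal labels (`Fintype.equivOfCardEq`) and extend the two injective coordinate maps to
labellings (`exists_blockEquiv_extend`). [folklore] -/
theorem exists_placement_on_rooks {n b : ℕ} (P : Finset (Fin n × Fin n))
    (hcard : P.card = b * b) (hfst : Set.InjOn Prod.fst (P : Set (Fin n × Fin n)))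
    (hsnd : Set.InjOn Prod.snd (P : Set (Fin n × Fin n))) (hfit : b + b * (b * 1) ≤ n) :
    ∃ eR eC : BlockV b 1 (n - (b + b * (b * 1))) ≃ Fin n,
      ∀ i j : Fin b, (eR (Sum.inr (Sum.inl (i, j, 0))), eC (Sum.inr (Sum.inl (i, j, 0)))) ∈ P := by
  classical
  -- index the rook set by the internal labels
  have hc : Fintype.card (Fin b × Fin b × Fin 1) = Fintype.card {e // e ∈ P} := by
    simp only [Fintype.card_prod, Fintype.card_fin, Fintype.card_coe, hcard, mul_one]
  let φ : (Fin b × Fin b × Fin 1) ≃ {e // e ∈ P} := Fintype.equivOfCardEq hc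
  have hρR : Function.Injective fun q => ((φ q : Fin n × Fin n)).1 := by
    intro q₁ q₂ hq
    exact φ.injective (Subtype.ext (hfst (φ q₁).2 (φ q₂).2 hq))
  have hρC : Function.Injective fun q => ((φ q : Fin n × Fin n)).2 := by
    intro q₁ q₂ hq
    exact φ.injective (Subtype.ext (hsnd (φ q₁).2 (φ q₂).2 hq))
  have hn : b + b * (b * 1) + (n - (b + b * (b * 1))) = n := Nat.add_sub_cancel' hfit
  obtain ⟨eR, heR⟩ := exists_blockEquiv_extend _ hρR hn
  obtain ⟨eC, heC⟩ := exists_blockEquiv_extend _ hρC hn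
  refine ⟨eR, eC, fun i j => ?_⟩
  rw [heR, heC]
  exact (φ (i, j, 0)).2

/-- **`stub_rookRigid` (K2 of line `pair-descent-jss-endpoint` for cofactors CONSTANT ON A ROOK
SET; skeleton v15, the lead's stub).**  For every `d` there is `n₀` such that for `n ≥ n₀`: if the
monomials of a nonzero torus-homogeneous `h` agree on a set `P` of at least `b²` cells in rook
position, `b = (log₂ n + d)^d`, then some placement `eR eC` of `G(b,1) ⊕ M₀` (doubly-internal cells
on the rooks, `exists_placement_on_rooks`), the generic cut `w` (`stub_genericCut`) and some `u`
satisfy `CutsOut w (placedBlock eR eC)` and `HasSingleGPart (placedBlock eR eC) w h u` — the top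
fibre is one monomial by the local rigidity `stub_midRigid`. [folklore] -/
theorem stub_rookRigid :
    ∀ d : ℕ, ∃ n₀ : ℕ, ∀ n ≥ n₀, ∀ h : MvPolynomial (Fin n × Fin n) ℝ≥0,
      h ≠ 0 → IsTorusHomogeneous h → ∀ P : Finset (Fin n × Fin n),
      (Nat.log 2 n + d) ^ d * (Nat.log 2 n + d) ^ d ≤ P.card →
      Set.InjOn Prod.fst (P : Set (Fin n × Fin n)) → Set.InjOn Prod.snd (P : Set (Fin n × Fin n)) →
      (∀ m₁ ∈ h.support, ∀ m₂ ∈ h.support, ∀ e ∈ P, m₁ e = m₂ e) →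
      ∃ (b k m : ℕ) (eR eC : BlockV b k m ≃ Fin n) (w : Fin n × Fin n → ℕ)
        (u : (Fin n × Fin n) →₀ ℕ),
        (Nat.log 2 n + d) ^ d ≤ b ∧ CutsOut w (placedBlock eR eC) ∧
          HasSingleGPart (placedBlock eR eC) w h u := by
  intro d
  obtain ⟨n₀, hfit⟩ := stub_blockFits d
  refine ⟨n₀ + 1, fun n hn h hh htor P hP hfst hsnd hconst => ?_⟩
  classical
  set b := (Nat.log 2 n + d) ^ d with hb
  have hbn : b + b * (b * 1) ≤ n := hfit n (by omega) 1 (by omega)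
  -- a rook subset of size exactly `b²`, and the placement on it
  obtain ⟨P', hP'P, hP'card⟩ := Finset.exists_subset_card_eq (show b * b ≤ P.card from hP)
  have hfst' : Set.InjOn Prod.fst (P' : Set (Fin n × Fin n)) :=
    hfst.mono (Finset.coe_subset.mpr hP'P)
  have hsnd' : Set.InjOn Prod.snd (P' : Set (Fin n × Fin n)) :=
    hsnd.mono (Finset.coe_subset.mpr hP'P)
  obtain ⟨eR, eC, hmidP⟩ := exists_placement_on_rooks P' hP'card hfst' hsnd' hbn
  set G := placedBlock eR eC with hG
  -- the generic cut: all monomials of `h` have the same degree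
  have hdeg : ∀ p₁ ∈ h.support, ∀ p₂ ∈ h.support, p₁.degree = p₂.degree := by
    intro p₁ hp₁ p₂ hp₂
    obtain ⟨r₀, c₀, hrc⟩ := htor
    exact degree_eq_of_rowDegrees_eq ((hrc p₁ hp₁).1.trans (hrc p₂ hp₂).1.symm)
  obtain ⟨w, hcut, hagree⟩ :=
    stub_genericCut b 1 (n - (b + b * (b * 1))) n eR eC h Nat.one_pos hdeg
  -- its top fibre is a single monomial
  have hfib : ∀ m₁ ∈ (topComponent w h).support, ∀ m₂ ∈ (topComponent w h).support,
      m₁ = m₂ := by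
    intro m₁ hm₁ m₂ hm₂
    have hs₁ := support_topComponent_subset _ h hm₁
    have hs₂ := support_topComponent_subset _ h hm₂
    obtain ⟨r₀, c₀, hrc⟩ := htor
    exact stub_midRigid b _ n eR eC m₁ m₂ (hagree m₁ hm₁ m₂ hm₂)
      ((hrc m₁ hs₁).1.trans (hrc m₂ hs₂).1.symm) ((hrc m₁ hs₁).2.trans (hrc m₂ hs₂).2.symm)
      fun i j => hconst m₁ hs₁ m₂ hs₂ _ (hP'P (hmidP i j))
  -- conclusion: `u` is the `G`-part of the unique monomial of the top fibre
  obtain ⟨m₀, hm₀⟩ := support_nonempty.mpr (topComponent_ne_zero w hh)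
  refine ⟨b, 1, n - (b + b * (b * 1)), eR, eC, w, m₀.filter (· ∈ G), le_rfl, hcut,
    fun e he => ?_, fun m' hm' e he => ?_⟩
  · rw [Finsupp.support_filter] at he
    exact (Finset.mem_filter.mp he).2
  · rw [hfib m' hm' m₀ hm₀, Finsupp.filter_apply_pos _ _ he]

end Summit.ValiantsHypothesis.ValiantsHypothesis.Theorems.DivisionGapPerDivisionHard

end
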